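import Summits.ResolutionOfSingularities.ResolutionOfSingularities.Theorems.HilbertSamuelEliminationSigmaMaxModificationsCorridor3WLadderIsoInsepE2NearLineTower
import Summits.ResolutionOfSingularities.ResolutionOfSingularities.Theorems.HilbertSamuelEliminationSigmaMaxModificationsCorridor3WLadderIsoInsepE2NearResidue
import Summits.ResolutionOfSingularities.ResolutionOfSingularities.Theorems.HilbertSamuelEliminationSigmaMaxModificationsCorridor3WLadderIsoInsepE2NearDirectrix
import Mathlib.Algebra.Polynomial.Degree.SmallDegree
import HarnessLib

/-!
# [OURS · L1 W4.2] E2 chart calculus, brick 19b: **THE NO-JUMP ROW `IsoInsepE2SuccInsep₂` PROVED** — in an isolated E3 point tower over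
# a maximal origin of characteristic two, the successor of an E2 stage has an INSEPARABLE directrix (`e(x_{n+1}) ≤ 2 < 3 ≤ ē(x_{n+1})`)
# (crux chain w42, cell k2 `T3insep` = `stub_isoInsepTower`; `--supports stmt-ResolutionOfSingularities-19249`)

OURS (cell res-hironaka, slot W4.2, seat res-D-pv-042; OWN OBJECT TUO 2026-08-27 18:19Z, (N4b) of the NJ/RC dictionary); NOT a
statement of [Hironaka2017] nor of [CossartJannsenSaito2020] / [CossartPiltant2008]. AI-drafted, weaker than expert review. PROOF
file, def-free, fact-free.

* `isoInsepE2SuccInsep₂_holds : IsoInsepE2SuccInsep₂.{0} N` (tree `…IsoInsepTailCutDefs`, C10's NO-JUMP row; OURS row). Proof: by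
  brick 16 (`exists_e2StepPresentation_rational`) the next point is the `κ`-rational point `𝔭 = (T_a, T_b, aT_{kc} + b)` of the
  exceptional line, so `𝔔 = (u, v, w̃, c_j)` with `w̃ = ã·c_{kc}/c_j + b̃` and `(u, v, w̃, c_j)/1` is a regular system of parameters of
  `B_𝔔`; the strict transform is `h′ = ĉ(u² + λ̂v²) + c_j·G`, `G ∈ 𝔔`, `ĉ` a unit, and `λ̂` is still a non-square modulo `𝔪_{B_𝔔}` because
  `κ(𝔔) = κ(R)` (brick 18a). Hence `e(x_{n+1}) + 2 ≤ 4` (brick 19a `E2Chart.dirDim_add_two_le_of_shape`), while `ē(x_{n+1}) ≥ 3` is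
  a tower hypothesis: stage `n + 1` is inseparable.

## References

* V. Cossart, U. Jannsen, S. Saito, LNM 2270 (2020): Def. 2.26, Thm. 3.10 (4), Cor. 4.23. [CossartJannsenSaito2020]
-/

noncomputable section

set_option linter.dupNamespace false

open scoped Classical
open CategoryTheory AlgebraicGeometry TopologicalSpace IsLocalRing MvPolynomial
open Literature.RingTheory.HilbertSamuel Literature.AlgebraicGeometry.Resolution Literature.AlgebraicGeometry.CossartJannsenSaito2020
open Summit.ResolutionOfSingularities.ResolutionOfSingularities.Theorems.CampaignW42
open Summit.ResolutionOfSingularities.ResolutionOfSingularities.Theorems.SigmaMaxModificationsCorridor3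
open Summit.ResolutionOfSingularities.ResolutionOfSingularities.Theorems.SigmaMaxModificationsCorridor3.Moving (exists_towerStructure)
open Summit.ResolutionOfSingularities.ResolutionOfSingularities.Cruxes.SigmaMaxModifications.IdeasL1Idea2R4 (IsIsoPointTower)
open Summit.ResolutionOfSingularities.ResolutionOfSingularities.Cruxes.SigmaMaxModifications.IdeasL1C5 (IsInsepStage)

namespace Summit.ResolutionOfSingularities.ResolutionOfSingularities.Cruxes.SigmaMaxModifications.IdeasL1C6

namespace E2Chart

universe u v w

/-- **GENERATORS OF `𝔔` AT A RATIONAL POINT OF THE LINE.** In a chart `π : B ↠ κ[T]` with `ker π = (t)`, let `𝔭` be a prime with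
`π⁻¹(𝔭) = 𝔔`, containing the variables `T_a = π u`, `T_b = π v` (all variables but `T_{kc}`) and the linear polynomial
`ℓ = a·T_{kc} + b = π w` (`a ≠ 0`). Then `𝔔 = (u, v, w, t)`. [OURS · L1 W4.2 · k2 · E2 chart calculus, brick 19b] [folklore] -/
theorem span_range_eq_of_rationalPoint {B : Type u} [CommRing B] {κ : Type v} [Field κ] {ι : Type w} (π : B →+* MvPolynomial ι κ)
    (hπ : Function.Surjective π) {t : B} (hker : RingHom.ker π = Ideal.span {t}) (𝔔 : Ideal B) (𝔭 : Ideal (MvPolynomial ι κ))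
    [𝔭.IsPrime] (hcomap : 𝔭.comap π = 𝔔) {kc a' b' : ι} (ha' : a' ≠ kc) (hb' : b' ≠ kc) (hothers : ∀ k : ι, k ≠ kc → k = a' ∨ k = b')
    {u v w : B} (hπu : π u = X a') (hπv : π v = X b') {a b : κ} (ha : a ≠ 0) (hπw : π w = C a * X kc + C b)
    (hu : u ∈ 𝔔) (hv : v ∈ 𝔔) (hw : w ∈ 𝔔) (ht : t ∈ 𝔔) : Ideal.span (Set.range ![u, v, w, t]) = 𝔔 := by
  have hXa : (X a' : MvPolynomial ι κ) ∈ 𝔭 := by rw [← hπu, ← Ideal.mem_comap, hcomap]; exact hu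
  have hXb : (X b' : MvPolynomial ι κ) ∈ 𝔭 := by rw [← hπv, ← Ideal.mem_comap, hcomap]; exact hv
  have hℓ : (C a * X kc + C b : MvPolynomial ι κ) ∈ 𝔭 := by rw [← hπw, ← Ideal.mem_comap, hcomap]; exact hw
  apply le_antisymm
  · rw [Ideal.span_le, Set.range_subset_iff]
    intro i
    fin_cases i
    exacts [hu, hv, hw, ht]
  intro z hz
  have hπz : π z ∈ 𝔭 := by rw [← hcomap, Ideal.mem_comap] at hz; exact hz
  -- the ideal `I = (T_a, T_b, ℓ) ⊆ 𝔭` contains `T_k − p_k` for the rational point `p = (0, 0, -b/a)`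
  set I : Ideal (MvPolynomial ι κ) := Ideal.span {(X a' : MvPolynomial ι κ), X b', C a * X kc + C b} with hIdef
  have hIa : (X a' : MvPolynomial ι κ) ∈ I := Ideal.subset_span (Set.mem_insert _ _)
  have hIb : (X b' : MvPolynomial ι κ) ∈ I := Ideal.subset_span (Set.mem_insert_of_mem _ (Set.mem_insert _ _))
  have hIℓ : (C a * X kc + C b : MvPolynomial ι κ) ∈ I :=
    Ideal.subset_span (Set.mem_insert_of_mem _ (Set.mem_insert_of_mem _ (Set.mem_singleton _)))
  have hIle : I ≤ 𝔭 := by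
    rw [hIdef, Ideal.span_le]
    intro x hx
    simp only [Set.mem_insert_iff, Set.mem_singleton_iff] at hx
    rcases hx with rfl | rfl | rfl
    exacts [hXa, hXb, hℓ]
  have hp : ∀ k : ι, (X k : MvPolynomial ι κ) - C ((fun k : ι => if k = kc then -b / a else 0) k) ∈ I := by
    intro k
    by_cases hk : k = kc
    · subst hk
      simp only [if_true]
      have e : (X k : MvPolynomial ι κ) - C (-b / a) = C a⁻¹ * (C a * X k + C b) := by
        rw [mul_add, ← mul_assoc, ← map_mul, inv_mul_cancel₀ ha, map_one, one_mul, ← map_mul, sub_eq_add_neg, ← map_neg, neg_div,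
          neg_neg, div_eq_inv_mul]
      rw [e]
      exact I.mul_mem_left _ hIℓ
    · simp only [if_neg hk, map_zero, sub_zero]
      rcases hothers k hk with rfl | rfl
      exacts [hIa, hIb]
  have hT := sub_C_eval_mem_of_forall_X_sub_C_mem I _ hp (π z)
  have hev : MvPolynomial.eval (fun k : ι => if k = kc then -b / a else 0) (π z) = 0 := by
    by_contra hne
    have hC : C (MvPolynomial.eval (fun k : ι => if k = kc then -b / a else 0) (π z)) ∈ 𝔭 := by
      have := 𝔭.sub_mem hπz (hIle hT)
      rwa [sub_sub_cancel] at this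
    apply Ideal.IsPrime.ne_top ‹𝔭.IsPrime›
    rw [Ideal.eq_top_iff_one]
    have := 𝔭.mul_mem_left (C (MvPolynomial.eval (fun k : ι => if k = kc then -b / a else 0) (π z))⁻¹) hC
    rwa [← map_mul, inv_mul_cancel₀ hne, map_one] at this
  rw [hev, map_zero, sub_zero] at hT
  -- pull back along `π`
  have hIeq : I = (Ideal.span {u, v, w}).map π := by
    rw [hIdef, Ideal.map_span, Set.image_insert_eq, Set.image_insert_eq, Set.image_singleton, hπu, hπv, hπw]
  rw [hIeq] at hT
  have hz' := Ideal.mem_comap.mpr hT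
  rw [Ideal.comap_map_of_surjective π hπ, ← RingHom.ker_eq_comap_bot, hker] at hz'
  obtain ⟨w₁, hw₁, k₁, hk₁, rfl⟩ := Submodule.mem_sup.mp hz'
  refine Ideal.add_mem _ (Ideal.span_mono ?_ hw₁) (Ideal.span_mono ?_ hk₁)
  · exact Set.insert_subset_iff.mpr ⟨⟨0, rfl⟩, Set.insert_subset_iff.mpr ⟨⟨1, rfl⟩, Set.singleton_subset_iff.mpr ⟨2, rfl⟩⟩⟩
  · exact Set.singleton_subset_iff.mpr ⟨3, rfl⟩

/-- **A NON-SQUARE STAYS A NON-SQUARE AT A RATIONAL POINT.** In the situation of brick 18a (`R` local, `B` an `R`-algebra,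
`π : B → κ[T]` with `π|_R = C ∘ residue`, `𝔔 = π⁻¹(𝔭)` prime with `𝔔 ∩ R = 𝔪_R`, a `κ`-point `p` with `T_k − p_k ∈ 𝔭`): if `λ̂ ∈ R` is
not a square modulo `𝔪_R` then `λ̂/1` is not a square modulo `𝔪_{B_𝔔}` (`κ(𝔔) = κ(R)`). [OURS · L1 W4.2 · k2 · E2 chart calculus,
brick 19b] [folklore] -/
theorem sq_sub_not_mem_of_rationalPoint {R : Type u} [CommRing R] [IsLocalRing R] {B : Type v} [CommRing B] [Algebra R B]
    {ι : Type w} (π : B →+* MvPolynomial ι (ResidueField R)) (hπalg : ∀ a : R, π (algebraMap R B a) = C (residue R a))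
    (𝔔 : Ideal B) [𝔔.IsPrime] (h𝔔R : 𝔔.comap (algebraMap R B) = maximalIdeal R) {𝔭 : Ideal (MvPolynomial ι (ResidueField R))}
    (hcomap : 𝔭.comap π = 𝔔) (p : ι → ResidueField R) (hp : ∀ k : ι, (X k : MvPolynomial ι (ResidueField R)) - C (p k) ∈ 𝔭)
    {lam : R} (hlam : ∀ r : R, r ^ 2 - lam ∉ maximalIdeal R) (z : Localization.AtPrime 𝔔) :
    z ^ 2 - algebraMap B (Localization.AtPrime 𝔔) (algebraMap R B lam) ∉ maximalIdeal (Localization.AtPrime 𝔔) := by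
  intro hz
  obtain ⟨r, hr⟩ := exists_sub_algebraMap_mem_maximalIdeal_of_rationalPoint π hπalg 𝔔 hcomap p hp z
  apply hlam r
  rw [← h𝔔R, Ideal.mem_comap, ← IsLocalization.AtPrime.to_map_mem_maximal_iff (Localization.AtPrime 𝔔) 𝔔]
  have e : algebraMap B (Localization.AtPrime 𝔔) (algebraMap R B (r ^ 2 - lam)) =
      (z ^ 2 - algebraMap B (Localization.AtPrime 𝔔) (algebraMap R B lam)) +
        (-(z + algebraMap B (Localization.AtPrime 𝔔) (algebraMap R B r))) *
          (z - algebraMap B (Localization.AtPrime 𝔔) (algebraMap R B r)) := by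
    simp only [map_sub, map_pow]
    ring
  rw [e]
  exact Ideal.add_mem _ hz (Ideal.mul_mem_left _ _ hr)

end E2Chart

/-- **THE NO-JUMP ROW: THE SUCCESSOR OF AN E2 STAGE IS INSEPARABLE.** In an isolated E3 point tower over a maximal origin of
characteristic two, if stage `n` is E2 then `e(x_{n+1}) < ē(x_{n+1})` (`IsInsepStage T pt (n + 1)`): at the rational next point
(brick 16) the strict transform is `ĉ(u² + λ̂v²) + c_j·G` in the regular parameters `(u, v, w̃, c_j)` of `B_𝔔`, `λ̂` is a non-square in
`κ(x_{n+1}) = κ(x_n)` (brick 18a), so `e(x_{n+1}) ≤ 2` (brick 19a) `< 3 ≤ ē(x_{n+1})`. [OURS · L1 W4.2 · k2 · E2 chart calculus, brick 19b]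
[folklore] -/
theorem isoInsepE2SuccInsep₂_holds (N : ℕ) : IsoInsepE2SuccInsep₂.{0} N := by
  intro ν T pt hO hT n hE
  -- brick 16, destructured in pieces
  obtain ⟨R, _, _, c, σ, h, cc, lam, hpt, -, hc, -, -, -, -, hcc, hlam, -, -, hrest⟩ :=
    exists_e2StepPresentation_rational hO hT n hE
  obtain ⟨j, 𝔔, h', σ', -, -, -, h𝔔, -, hreg, hσ', hker', -, -, -, -, hh'2, hh'3, hfr0, hfr1, hj0, hj1, hrest⟩ := hrest
  obtain ⟨F, -, -, heq, hG, -, hrest⟩ := hrest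
  obtain ⟨π, 𝔭, h𝔭p, kc, P, hπsurj, hπalg, hπfrac, hkerπ, -, hcomap, ⟨hkc0, hkc1⟩, hvars, hP, -, -, -, -, -, hdeg⟩ := hrest
  haveI := h𝔭p
  haveI hregL : IsRegularLocalRing (Localization.AtPrime 𝔔.asIdeal) := hreg
  haveI : IsLocallyNoetherian (T.X (n + 1)) := T.ln (n + 1)
  -- residue characteristic two at the next point
  obtain ⟨k₀, _, _, f₀, hsep, hft, hqc⟩ := hO.exists_structure
  haveI := hsep
  haveI := hft
  haveI := hqc
  obtain ⟨f, -, -, -⟩ := exists_towerStructure T f₀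
  obtain ⟨φ⟩ := exists_ringHom_field_stalk (f (n + 1)) (pt (n + 1))
  haveI : CharP (ResidueField ((T.X (n + 1)).presheaf.stalk (pt (n + 1)))) 2 :=
    charP_of_injective_ringHom ((residue _).comp φ).injective 2
  -- `c_j ∈ 𝔔`
  have hcj𝔔 : algebraMap R (blowupAlgebra (Ideal.span (Set.range c)) (c j)) (c j) ∈ 𝔔.asIdeal := by
    have : c j ∈ 𝔔.asIdeal.comap (algebraMap R (blowupAlgebra (Ideal.span (Set.range c)) (c j))) := by
      rw [h𝔔, ← hc]; exact Ideal.subset_span (Set.mem_range_self j)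
    exact this
  have hmemL : ∀ {z : blowupAlgebra (Ideal.span (Set.range c)) (c j)}, z ∈ 𝔔.asIdeal →
      algebraMap (blowupAlgebra (Ideal.span (Set.range c)) (c j)) (Localization.AtPrime 𝔔.asIdeal) z ∈
        maximalIdeal (Localization.AtPrime 𝔔.asIdeal) :=
    fun {z} hz => (IsLocalization.AtPrime.to_map_mem_maximal_iff (Localization.AtPrime 𝔔.asIdeal) 𝔔.asIdeal z).mpr hz
  have hmemL' : ∀ {z : blowupAlgebra (Ideal.span (Set.range c)) (c j)},
      algebraMap (blowupAlgebra (Ideal.span (Set.range c)) (c j)) (Localization.AtPrime 𝔔.asIdeal) z ∈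
        maximalIdeal (Localization.AtPrime 𝔔.asIdeal) → z ∈ 𝔔.asIdeal :=
    fun {z} hz => (IsLocalization.AtPrime.to_map_mem_maximal_iff (Localization.AtPrime 𝔔.asIdeal) 𝔔.asIdeal z).mp hz
  -- the rational point `(0, 0, -b/a)`, `P = aT + b`
  obtain ⟨a, b, hab⟩ := Polynomial.exists_eq_X_add_C_of_natDegree_le_one hdeg.le
  have ha : a ≠ 0 := by
    rintro rfl
    rw [map_zero, zero_mul, zero_add] at hab
    rw [hab, Polynomial.natDegree_C] at hdeg
    exact zero_ne_one hdeg
  have hPmem : Polynomial.aeval (MvPolynomial.X kc : MvPolynomial {k : Fin 4 // k ≠ j} (ResidueField R)) P ∈ 𝔭 := by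
    have : P ∈ 𝔭.comap (Polynomial.aeval (MvPolynomial.X kc : MvPolynomial {k : Fin 4 // k ≠ j} (ResidueField R))) := by
      rw [hP]; exact Ideal.mem_span_singleton_self P
    exact this
  have hℓ : Polynomial.aeval (MvPolynomial.X kc : MvPolynomial {k : Fin 4 // k ≠ j} (ResidueField R)) P = C a * X kc + C b := by
    rw [hab, map_add, map_mul, Polynomial.aeval_C, Polynomial.aeval_X, Polynomial.aeval_C, MvPolynomial.algebraMap_eq]
  have hXkc : ∀ I : Ideal (MvPolynomial {k : Fin 4 // k ≠ j} (ResidueField R)),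
      Polynomial.aeval (MvPolynomial.X kc : MvPolynomial {k : Fin 4 // k ≠ j} (ResidueField R)) P ∈ I →
        (MvPolynomial.X kc : MvPolynomial {k : Fin 4 // k ≠ j} (ResidueField R)) - C (-b / a) ∈ I := by
    intro I hI
    have e : (MvPolynomial.X kc : MvPolynomial {k : Fin 4 // k ≠ j} (ResidueField R)) - C (-b / a) =
        C a⁻¹ * Polynomial.aeval (MvPolynomial.X kc : MvPolynomial {k : Fin 4 // k ≠ j} (ResidueField R)) P := by
      rw [hℓ, mul_add, ← mul_assoc, ← map_mul, inv_mul_cancel₀ ha, map_one, one_mul, ← map_mul, sub_eq_add_neg, ← map_neg, neg_div,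
        neg_neg, div_eq_inv_mul]
    rw [e]
    exact I.mul_mem_left _ hI
  have ha' : (⟨0, fun h => hj0 h.symm⟩ : {k : Fin 4 // k ≠ j}) ≠ kc := fun h => hkc0 (congrArg Subtype.val h).symm
  have hb' : (⟨1, fun h => hj1 h.symm⟩ : {k : Fin 4 // k ≠ j}) ≠ kc := fun h => hkc1 (congrArg Subtype.val h).symm
  have hothers : ∀ k : {k : Fin 4 // k ≠ j}, k ≠ kc → k = ⟨0, fun h => hj0 h.symm⟩ ∨ k = ⟨1, fun h => hj1 h.symm⟩ := by
    intro k hk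
    have hkj' : k.1.val ≠ j.val := fun h => k.2 (Fin.ext h)
    have hkkc : k.1.val ≠ kc.1.val := fun h => hk (Subtype.ext (Fin.ext h))
    have hkc0' : kc.1.val ≠ 0 := fun h => hkc0 (Fin.ext h)
    have hkc1' : kc.1.val ≠ 1 := fun h => hkc1 (Fin.ext h)
    have hkcj : kc.1.val ≠ j.val := fun h => kc.2 (Fin.ext h)
    have hj0' : j.val ≠ 0 := fun h => hj0 (Fin.ext h)
    have hj1' : j.val ≠ 1 := fun h => hj1 (Fin.ext h)
    have := k.1.isLt
    have := kc.1.isLt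
    have := j.isLt
    have h01 : k.1.val = 0 ∨ k.1.val = 1 := by omega
    rcases h01 with h01 | h01
    · exact Or.inl (Subtype.ext (Fin.ext h01))
    · exact Or.inr (Subtype.ext (Fin.ext h01))
  have hp : ∀ k : {k : Fin 4 // k ≠ j}, (MvPolynomial.X k : MvPolynomial {k : Fin 4 // k ≠ j} (ResidueField R)) -
      C ((fun k : {k : Fin 4 // k ≠ j} => if k = kc then -b / a else 0) k) ∈ 𝔭 := by
    intro k
    by_cases hk : k = kc
    · subst hk
      simp only [if_true]
      exact hXkc 𝔭 hPmem
    · simp only [if_neg hk, map_zero, sub_zero]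
      exact hvars k hk
  -- the fourth parameter `w̃ = ã·(c_{kc}/c_j) + b̃`
  obtain ⟨a₁, hat⟩ := Ideal.Quotient.mk_surjective (I := maximalIdeal R) a
  obtain ⟨b₁, hbt⟩ := Ideal.Quotient.mk_surjective (I := maximalIdeal R) b
  have hat' : residue R a₁ = a := hat
  have hbt' : residue R b₁ = b := hbt
  set wt : blowupAlgebra (Ideal.span (Set.range c)) (c j) :=
    algebraMap R _ a₁ * blowupAlgebra.frac c j kc.1 + algebraMap R _ b₁ with hwt
  have hπw : π wt = Polynomial.aeval (MvPolynomial.X kc : MvPolynomial {k : Fin 4 // k ≠ j} (ResidueField R)) P := by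
    rw [hwt, map_add, map_mul, hπalg, hπalg, hπfrac kc.1 kc.2, hat', hbt', hℓ]
  have hw𝔔 : wt ∈ 𝔔.asIdeal := by
    rw [← hcomap, Ideal.mem_comap, hπw]
    exact hPmem
  -- `𝔔 = (u, v, w̃, c_j)`
  set yB : Fin 4 → blowupAlgebra (Ideal.span (Set.range c)) (c j) :=
    ![blowupAlgebra.frac c j 0, blowupAlgebra.frac c j 1, wt, algebraMap R _ (c j)] with hyB
  have hπw' : π wt = C a * MvPolynomial.X kc + C b := by rw [hπw, hℓ]
  have h𝔔gen : Ideal.span (Set.range yB) = 𝔔.asIdeal :=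
    E2Chart.span_range_eq_of_rationalPoint π hπsurj hkerπ 𝔔.asIdeal 𝔭 hcomap ha' hb' hothers (hπfrac 0 fun h => hj0 h.symm)
      (hπfrac 1 fun h => hj1 h.symm) ha hπw' hfr0 hfr1 hw𝔔 hcj𝔔
  -- the regular parameters `(u, v, w̃, c_j)/1` of `B_𝔔`
  set y' : Fin 4 → Localization.AtPrime 𝔔.asIdeal :=
    (algebraMap (blowupAlgebra (Ideal.span (Set.range c)) (c j)) (Localization.AtPrime 𝔔.asIdeal)) ∘ yB with hy'def
  have hy' : Ideal.span (Set.range y') = maximalIdeal (Localization.AtPrime 𝔔.asIdeal) := by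
    rw [hy'def, Set.range_comp, ← Ideal.map_span, h𝔔gen, Localization.AtPrime.map_eq_maximalIdeal]
  -- `dim B_𝔔 = emb.dim B_𝔔 = 4`
  have hdp' : IsFormalDoublePointAt (T.X (n + 1)) (pt (n + 1)) := isFormalDoublePointAt_succ_of_isIsoPointTower hO hT n hE.2.1
  have hdim3 : ringKrullDim ((T.X (n + 1)).presheaf.stalk (pt (n + 1))) = (3 : ℕ) :=
    ringKrullDim_stalk_eq_three_of_isFormalDoublePointAt hdp'
  have hL4 : ringKrullDim (Localization.AtPrime 𝔔.asIdeal) = (4 : ℕ) := by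
    have h0 : algebraMap (blowupAlgebra (Ideal.span (Set.range c)) (c j)) (Localization.AtPrime 𝔔.asIdeal) h' ≠ 0 := fun h0 =>
      hh'3 (by rw [h0]; exact Submodule.zero_mem _)
    have h𝔪 : algebraMap (blowupAlgebra (Ideal.span (Set.range c)) (c j)) (Localization.AtPrime 𝔔.asIdeal) h' ∈
        maximalIdeal (Localization.AtPrime 𝔔.asIdeal) := Ideal.pow_le_self two_ne_zero hh'2
    exact @ringKrullDim_eq_four_of_surjective_of_ker_eq (Localization.AtPrime 𝔔.asIdeal) _ _ hregL _ σ' hσ' _ hker' h0 h𝔪 hdim3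
  have hd' : (maximalIdeal (Localization.AtPrime 𝔔.asIdeal)).spanFinrank = 4 := by
    have := hregL.spanFinrank_maximalIdeal
    rw [hL4] at this
    exact_mod_cast this
  -- the shape in `B_𝔔`
  have hshapeL := congrArg (algebraMap (blowupAlgebra (Ideal.span (Set.range c)) (c j)) (Localization.AtPrime 𝔔.asIdeal)) heq
  simp only [map_add, map_mul, map_pow] at hshapeL
  have hh'3' : algebraMap (blowupAlgebra (Ideal.span (Set.range c)) (c j)) (Localization.AtPrime 𝔔.asIdeal) h' ∉
      maximalIdeal (Localization.AtPrime 𝔔.asIdeal) ^ (2 + 1) := by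
    rw [show (2 + 1 : ℕ) = 3 from rfl]; exact hh'3
  -- `ĉ` is a unit and `λ̂` a non-square in `B_𝔔`
  have hccL : algebraMap (blowupAlgebra (Ideal.span (Set.range c)) (c j)) (Localization.AtPrime 𝔔.asIdeal)
      (algebraMap R (blowupAlgebra (Ideal.span (Set.range c)) (c j)) cc) ∉ maximalIdeal (Localization.AtPrime 𝔔.asIdeal) := by
    intro hmem
    apply hcc
    have h1 : algebraMap R (blowupAlgebra (Ideal.span (Set.range c)) (c j)) cc ∈ 𝔔.asIdeal := hmemL' hmem
    rw [← h𝔔]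
    exact h1
  have hlamL : ∀ w : Localization.AtPrime 𝔔.asIdeal,
      w ^ 2 - algebraMap (blowupAlgebra (Ideal.span (Set.range c)) (c j)) (Localization.AtPrime 𝔔.asIdeal)
        (algebraMap R (blowupAlgebra (Ideal.span (Set.range c)) (c j)) lam) ∉ maximalIdeal (Localization.AtPrime 𝔔.asIdeal) :=
    E2Chart.sq_sub_not_mem_of_rationalPoint π hπalg 𝔔.asIdeal h𝔔 hcomap _ hp hlam
  have hGL : algebraMap (blowupAlgebra (Ideal.span (Set.range c)) (c j)) (Localization.AtPrime 𝔔.asIdeal)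
      (MvPolynomial.aeval (blowupAlgebra.frac c j) F) ∈ maximalIdeal (Localization.AtPrime 𝔔.asIdeal) := hmemL hG
  -- brick 19a: `e(x_{n+1}) + 2 ≤ 4`
  have hle := @E2Chart.dirDim_add_two_le_of_shape (Localization.AtPrime 𝔔.asIdeal) ((T.X (n + 1)).presheaf.stalk (pt (n + 1)))
    _ hregL _ _ _ _ 4 hd' y' hy' σ' hσ' _ hker' hh'2 hh'3' 0 1 3 (by decide) (by decide) (by decide) _ _ _ _ _ _ rfl rfl rfl
    hccL hlamL hGL hshapeL
  -- `ē(x_{n+1}) ≥ 3`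
  have h3 : 3 ≤ Scheme.geomDirDim (T.X (n + 1)) (pt (n + 1)) := hT.2.2.2.2.2 (n + 1)
  show Scheme.dirDim (T.X (n + 1)) (pt (n + 1)) < Scheme.geomDirDim (T.X (n + 1)) (pt (n + 1))
  have hle' : Scheme.dirDim (T.X (n + 1)) (pt (n + 1)) + 2 ≤ 4 := hle
  omega

end Summit.ResolutionOfSingularities.ResolutionOfSingularities.Cruxes.SigmaMaxModifications.IdeasL1C6

end
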